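import Literature.MathematicalPhysics.QuantumFieldTheory.Balaban1983to89.B9Thm312WholeLeft
import Literature.MathematicalPhysics.QuantumFieldTheory.Balaban1983to89.B9RowSum261DefiniteFaces
import Literature.MathematicalPhysics.QuantumFieldTheory.Balaban1983to89.Node00.OpsYOfLetters

/-!
# `Balaban1983to89.B9Thm312WholeFacesY` — [B9] Theorems 3.12 ∕ 3.13 (pp. 423, 426): the record-level FACES of the row-20∕21 leaves
# that close BY NAME — [4] Lemma 2.1 at the geometry of record, and the null (3.47) readings OFF the bond summand

T. Bałaban, *Propagators for lattice gauge theories in a background field*, Commun. Math. Phys. **99** (1985) 389–434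
[`Balaban1985BackgroundPropagators`, "B9"]; [4] = T. Bałaban, *Propagators and renormalization transformations for lattice gauge
theories. II*, Commun. Math. Phys. **96** (1984) 223–250 [`Balaban1984PropagatorsII`].

statement-level skeleton of published theorems with citation tags; proofs where landed; nothing here is a claim about the
Yang–Mills mass gap

THE PRINTED LOCI.  [4] Lemma 2.1 p. 234: (2.60) *"e^{−αδ₀d(y,y′)} ≦ e^{−αδ₀RM max{|j−j′|−1,0}}"*, (2.61) *"sup_{y∈𝔅} Σ_{y′∈𝔅} e^{−αδ₀d(y,y′)} ≦
c₁(α)"* for *"RM satisfying (2.59)"*; [B9] (3.47) p. 398 (the global weighted norms, vector arguments for G, G₁, 𝔊 — Thm 3.3 p. 399: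
*"the same statements hold for the operators G(U)"*; Thm 3.12 p. 423; Thm 3.13 p. 426).

THE POINT.  The row-20∕21 leaves of seat n06-l (`…B9Thm312WholeLeafLeftGlob.thm312Printed_of_stepD`, `…B9Thm312WholeLeafH.thm312Printed_of_stepDH`,
`…B9Thm313WholeLeafLeft.thm313Printed_of_stepD`) carry, among their inputs, two binders that the N06 knit (seat n06-d) must supply AT
def-Y's instance `ops := Node00.opsYOfLetters N θ M⋆ 𝔏 𝔈` over the members `geo9Y x`:
* `hL21 : ∀ δ > 0, ∃ ML′ c′, B9Thm312WholeLeft.Lemma21AboveG geo R₀ H₀ δ α ML′ c′` — [4] Lemma 2.1 above an M-threshold at every rate with a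
  GENERIC row-sum constant.  §1 ★ `lemma21AboveG_geo9Y`: at `geo := geo9Y`, `R₀ := fun _ => 1`, every `H`, every 0 < α < 1 it HOLDS BY NAME —
  n06-j's `B9RowSum261DefiniteFaces.lemma21Above_geo9Y` (n06-i's `levelGap_geo9Y_one`, `rowSum261_geo9Y`, `distOK_geo9Y`) through
  `B9Thm312WholeLeft.lemma21AboveG_of_above`.  (The knit's transport binder `R12` is free: take `R12 := fun _ => 1`.)
* `hnull : … ¬ PG i lam → (GD i).glob n U lam γ ≤ 0 ∧ (G₁ i).glob n U lam γ ≤ 0` (row 20), `… → (GG i).glob n U lam γ ≤ 0` (row 21) — the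
  (3.47) readings vanish OFF the sub-family `PG`.  §2: at the instance the families `GD`, `G₁`, `GG` are def-Y's bond-sector readings
  `Node00.kernelFamilyB … 𝔏.GD ∕ 𝔏.G₁ ∕ 𝔏.GG`, whose `glob` is `0` on the site summand BY DEFINITION (`GD_glob_inl`, `G₁_glob_inl`, `GG_glob_inl`,
  `rfl`); hence ★ `hnull12_opsYOfLetters`, ★ `hnull13_opsYOfLetters` — the two binders LITERALLY at `PG := fun lam => lam.isRight = true`
  (the pattern of n06-g's `B9Cor35ComparisonsGAAtLetters.hnullGA_opsYOfLetters` for `GA`).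

WHAT IS NOT HERE, AND WHY (located).  The POSITIVE reading structure `B9Ineq347Reading.GlobReading (kernelFamilyB …) (isRight) U res` (the
leaves' binder `hread`, and rows 11–12's `hRGp`∕`hRGA`) is NOT constructed: at the geometry of record `geo9K i` the sites are the INDEX BONDS
`c` and every (3.42) reading `K.e n U λ c` reads the carrier block `β c`; a block of 𝔅 that is the carrier block of NO index bond (an
«orphan» block — e.g. in one dimension with k = 2 the top level-1 block below a component of Ω₂; such members exist as typed) is invisible to
every (3.42) reading while `K.glob` (3.47) reads every fine bond, so `GlobReading.glob_le` ∕ `.e_subadd` cannot be derived for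
`kernelFamilyB` (seat memo `ORPHAN-BLOCKS-MEMO.md` of the cell, 2026-08-27).  The (3.47) members at the record therefore stay fed through
the displayed `hread`, exactly as rows 11–12 through `hRGp`∕`hRGA`.

HONEST SCOPE.  Kernel bookkeeping at the record's carriers: one instantiation of n06-j's Lemma-2.1 face and three definitional unfoldings;
nothing of [B9] or [4] asserted; count-neutral; N06 NOT discharged; one finite lattice programme at a time — nothing continuum, nothing
about the mass gap.  Cell `pub-ymgap` (HUMAN RULING D-0062), Track A node N06 [B9], N06-ASSIGNMENT v1 rows 20–21 (bundle F7), seat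
`pub-ymgap-dag-n06-l` (g3), 2026-08-27.
-/

noncomputable section

namespace Literature.MathematicalPhysics.QuantumFieldTheory.Balaban1983to89.B9Thm312WholeFacesY

open B9Thm312WholeLeft (Lemma21AboveG lemma21AboveG_of_above)
open B9RowSum261DefiniteFaces (lemma21Above_geo9Y)
open B9PinMembersKLevelV1 (MemberY geo9Y bg9Y)
open B7Prop2SpecialUnitary (specialUnitaryUnits)
open Node00 (SiteY FBondY CfgY kernelFamilyB CovLettersY ExpLettersY operatorLayerYOfLetters LettersY ExpsY opsYOfLetters Stage3Params)
open scoped Matrix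

variable {d ℓ : ℕ} {hd : 1 ≤ d + 1} {hL : Odd (ℓ + 1) ∧ 1 < ℓ + 1} {b₀ b₁ : ℝ} {Mstar : ℕ}

/-! ## §1 [4] Lemma 2.1 in the GENERIC-CONSTANT form `Lemma21AboveG` at the geometry of record, BY NAME -/

section Lemma21

variable [∀ x : MemberY d ℓ hd hL b₀ b₁ Mstar, Fintype (geo9Y x).Site]

/-- ★ **[4] LEMMA 2.1 «RM SUFFICIENTLY LARGE», GENERIC ROW-SUM CONSTANT, AT THE GEOMETRY OF RECORD** (the `hL21` binder of the row-20∕21 leaves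
`thm312Printed_of_stepD`∕`…DH`, `thm313Printed_of_stepD` at `geo := geo9Y`, `R₀ := fun _ => 1`): for every 0 < α < 1 and every δ > 0 there are
an M-threshold `ML′` and a constant `c′` with `Lemma21AboveG geo9Y (fun _ => 1) H δ α ML′ c′` — (2.60) at (δ, α), the row sum (2.61) at (1 − α)δ
with the constant c′ = c₁(1 − α) at the exponent n06-j's free-exponent door delivers, and 4·log L ≦ αδ·1·M.  Proof: n06-j's
`lemma21Above_geo9Y` + `lemma21AboveG_of_above`. [cite: Balaban1984PropagatorsII, Lemma 2.1 (2.59)–(2.61) pp.233–234] -/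
theorem lemma21AboveG_geo9Y (H : MemberY d ℓ hd hL b₀ b₁ Mstar → Prop) {α : ℝ} (hα0 : 0 < α) (hα1 : α < 1) :
    ∀ δ : ℝ, 0 < δ → ∃ ML' c' : ℝ,
      Lemma21AboveG (geo9Y (d := d) (ℓ := ℓ) (hd := hd) (hL := hL) (b₀ := b₀) (b₁ := b₁) (Mstar := Mstar))
        (fun _ => (1 : ℝ)) H δ α ML' c' := by
  intro δ hδ
  obtain ⟨dd, ML, h⟩ := lemma21Above_geo9Y (d := d) (ℓ := ℓ) (hd := hd) (hL := hL) (b₀ := b₀) (b₁ := b₁) (Mstar := Mstar) H hα0 hα1 hδ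
  exact ⟨ML, _, lemma21AboveG_of_above dd h⟩

end Lemma21

/-! ## §2 The (3.47) readings of `GD`, `G₁`, `GG` vanish OFF the bond summand (def-Y's `kernelFamilyB`, by definition) -/

section Member

variable {𝔸 : Type} [NormedRing 𝔸] [NormedAlgebra ℂ 𝔸] [CompleteSpace 𝔸]
variable {G : Subgroup 𝔸ˣ} (x : MemberY d ℓ hd hL b₀ b₁ Mstar) (𝔏 : CovLettersY 𝔸 x) (𝔈 : ExpLettersY 𝔸 G x)

/-- OFF the bond summand the (3.47) reading of `𝔾_D(U)` (`GD.glob`) is `0` (site arguments), at every `U`, `γ`.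
[cite: Balaban1985BackgroundPropagators, (3.47) p.398 + Thm 3.12 p.423, bookkeeping] -/
theorem GD_glob_inl (n : Fin 4) (U : (bg9Y 𝔸 G x).Cfg) (f : SiteY x.toKIdx → ℝ) (γ : ℝ) :
    (operatorLayerYOfLetters 𝔸 G x 𝔏 𝔈).GD.glob n U (Sum.inl f) γ = 0 := rfl

/-- OFF the bond summand the (3.47) reading of `G₁(U)` (`G₁.glob`) is `0`. [cite: Balaban1985BackgroundPropagators, (3.47) p.398 + Thm 3.12 p.423, bookkeeping] -/
theorem G₁_glob_inl (n : Fin 4) (U : (bg9Y 𝔸 G x).Cfg) (f : SiteY x.toKIdx → ℝ) (γ : ℝ) :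
    (operatorLayerYOfLetters 𝔸 G x 𝔏 𝔈).G₁.glob n U (Sum.inl f) γ = 0 := rfl

/-- OFF the bond summand the (3.47) reading of `𝔊(U)` (`GG.glob`) is `0`. [cite: Balaban1985BackgroundPropagators, (3.47) p.398 + Thm 3.13 p.426, bookkeeping] -/
theorem GG_glob_inl (n : Fin 4) (U : (bg9Y 𝔸 G x).Cfg) (f : SiteY x.toKIdx → ℝ) (γ : ℝ) :
    (operatorLayerYOfLetters 𝔸 G x 𝔏 𝔈).GG.glob n U (Sum.inl f) γ = 0 := rfl

end Member

/-! ## §3 At the record: the `hnull` binders of rows 20 and 21 at `ops := opsYOfLetters N θ M⋆ 𝔏 𝔈`, verbatim -/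

section Record

open scoped Matrix.Norms.L2Operator

variable (N : ℕ) (θ : Stage3Params) (Mstar : ℕ) (𝔏 : LettersY N θ Mstar) (𝔈 : ExpsY N θ Mstar)

/-- ★ **THE `hnull` BINDER OF ROW 20** (`thm312Printed_of_stepD` ∕ `thm312Printed_of_stepDH` at `GD := fun x => (ops x).GD`, `G₁ := fun x => (ops x).G₁`,
`PG := fun _ lam => lam.isRight = true`, `ops := opsYOfLetters N θ M⋆ 𝔏 𝔈`): OFF the bond summand both (3.47) readings are `≤ 0`, at every `U`.
[cite: Balaban1985BackgroundPropagators, (3.47) p.398 + Thm 3.12 p.423, bookkeeping] -/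
theorem hnull12_opsYOfLetters :
    ∀ (x : MemberY θ.d₆ θ.ℓ₆ θ.hd' θ.hL' θ.b₀ θ.b₁ Mstar) (U : (bg9Y (Matrix (Fin N) (Fin N) ℂ) (specialUnitaryUnits (Fin N)) x).Cfg)
      (n : Fin 4) (lam : (geo9Y x).Loc) (γ : ℝ), ¬ (lam.isRight = true) →
      ((opsYOfLetters N θ Mstar 𝔏 𝔈) x).GD.glob n U lam γ ≤ 0 ∧ ((opsYOfLetters N θ Mstar 𝔏 𝔈) x).G₁.glob n U lam γ ≤ 0 := by
  intro x U n lam γ hlam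
  cases lam with
  | inl f => exact ⟨(GD_glob_inl x (𝔏 x) (𝔈 x) n U f γ).le, (G₁_glob_inl x (𝔏 x) (𝔈 x) n U f γ).le⟩
  | inr J => exact absurd rfl hlam

/-- ★ **THE `hnull` BINDER OF ROW 21** (`thm313Printed_of_stepD` at `GG := fun x => (ops x).GG`, `PG := fun _ lam => lam.isRight = true`,
`ops := opsYOfLetters N θ M⋆ 𝔏 𝔈`): OFF the bond summand the (3.47) reading of 𝔊 is `≤ 0`, at every `U`.
[cite: Balaban1985BackgroundPropagators, (3.47) p.398 + Thm 3.13 p.426, bookkeeping] -/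
theorem hnull13_opsYOfLetters :
    ∀ (x : MemberY θ.d₆ θ.ℓ₆ θ.hd' θ.hL' θ.b₀ θ.b₁ Mstar) (U : (bg9Y (Matrix (Fin N) (Fin N) ℂ) (specialUnitaryUnits (Fin N)) x).Cfg)
      (n : Fin 4) (lam : (geo9Y x).Loc) (γ : ℝ), ¬ (lam.isRight = true) →
      ((opsYOfLetters N θ Mstar 𝔏 𝔈) x).GG.glob n U lam γ ≤ 0 := by
  intro x U n lam γ hlam
  cases lam with
  | inl f => exact (GG_glob_inl x (𝔏 x) (𝔈 x) n U f γ).le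
  | inr J => exact absurd rfl hlam

end Record

end Literature.MathematicalPhysics.QuantumFieldTheory.Balaban1983to89.B9Thm312WholeFacesY

end
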